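import Literature.Geometry.GeometricMeasureTheory.VagueConvergence
import Literature.Geometry.GeometricMeasureTheory.ConstantVectorfield
import Literature.Geometry.GeometricMeasureTheory.TranslationInvariantMeasures
import Literature.Geometry.GeometricMeasureTheory.LimitSlicesRectifiable
import Literature.Geometry.GeometricMeasureTheory.MassComplete
import HarnessLib

/-!
# Blow-ups of a cycle `σ ∧ ξ` at a point: cone limits, invariance, lower density, growth

Support file for the proof of the named fact
`Literature.Geometry.GeometricMeasureTheory.Federer1969_compactness_integralCurrents` along
B. White's structure-theorem-free proof of the closure theorem [White1989, pp. 216–218;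
Bandara2006, §4.1]. For a finite measure `σ` on `V`, an integrable `(k+1)`-vectorfield `ξ` and a
point `a` we study the **blow-up currents**
`T_{a,r} = (η_{a,r})_# (σ ∧ ξ) = σ_{a,r} ∧ (ξ ∘ D_{a,r})`, `η_{a,r}(x) = r⁻¹(x − a)`,
`D_{a,r}(y) = a + r y`, `σ_{a,r} = r^{-(k+1)} (η_{a,r})_# σ` (`Measure.blowUp`):

* `blowUpCurrent`, `blowUpCurrent_apply_eq` (`T_{a,r}(φ) = (σ ∧ ξ)(r^{-(k+1)} φ ∘ η_{a,r})`),
  `boundary_blowUpCurrent_eq_zero` (blow-ups of cycles are cycles);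
* **cone limits** (`tendsto_blowUpCurrent_apply`, `tendsto_blowUpCurrent_restrict_apply`): if
  `σ_{a,λ_l} → ν` vaguely and `a` is a (normalised) Lebesgue point of `ξ`, then
  `T_{a,λ_l} ⇀ ν ∧ ξ(a)` (also restricted to `ν`-continuity sets), a cycle
  (`boundary_blowUpLimit_eq_zero`), so that `ν` is invariant under the invariant subspace of
  `ξ(a)` (`blowUpLimit_map_add_eq_self`, via `ConstantVectorfield`), which has dimension `k + 1`
  under a uniform lower density bound (`finrank_invariantSubspace_blowUpLimit`, via
  `TranslationInvariantMeasures`); masses: `variation_blowUpCurrent_le_add`,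
  `tendsto_variation_blowUpCurrent_of_null`; continuity sets with continuous weights:
  `Measure.VagueTendsto.tendsto_set(L)Integral_of_null_frontier`;
* **uniform lower density of the limit** (`le_blowUpLimit_closedBall`, the "Egorov trick"
  replacing White's use of the lower-density lemma on the infinite-mass cone): if `a` is a
  density point of a set `M'` on which `‖σ ∧ ξ‖(𝐁(x,r)) ≥ (βr)^{k+1}` for `r ≤ r₁`, then
  `ν(𝐁(y, r)) ≥ (βr/2)^{k+1}/‖ξ(a)‖` for EVERY `y ∈ spt ν` and EVERY `r > 0`;
* **growth of the limit** (`blowUpLimit_ball_le`, `blowUpLimit_closedBall_le`):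
  `Θ^{*(k+1)}(σ, a) ≤ 1` gives `ν(B(0,R)) ≤ α(k+1) R^{k+1}`.

Definitions with bodies and theorems only; no named facts.

## References

* B. White, *A new proof of the compactness theorem for integral currents*, Comment. Math.
  Helv. 64 (1989) 207–220, pp. 216–218 [White1989].
* L. Bandara, *The closure theorem for integral currents without the structure theorem*,
  B.Sc. thesis, ANU 2006, §4.1, pp. 38–42 [Bandara2006].
* H. Federer, *Geometric Measure Theory*, Springer 1969, 4.1.7, 2.10.19 [Federer1969].
* P. Mattila, *Geometry of Sets and Measures in Euclidean Spaces*, CUP 1995, Thm. 1.24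
  [Mattila1995].
-/

noncomputable section

open scoped Distributions ENNReal NNReal Topology Pointwise
open MeasureTheory TopologicalSpace Set Filter Metric Function

namespace Literature.Geometry.GeometricMeasureTheory

-- Nested operator-norm instances on (duals of) `E [⋀^Fin m]→L[ℝ] ℝ`, as in `Currents.lean`.
set_option maxSynthPendingDepth 3

variable {V : Type*} [NormedAddCommGroup V] [InnerProductSpace ℝ V] [FiniteDimensional ℝ V]
  [MeasurableSpace V] [BorelSpace V] {k : ℕ}

/-! ### Blow-up currents -/

section BlowUpCurrent

/-- **The blow-up current** `T_{a,r} = σ_{a,r} ∧ (ξ ∘ D_{a,r})` of `σ ∧ ξ` at `a` with scale `r`,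
`D_{a,r}(y) = a + r y`; it is the push-forward `(η_{a,r})_# (σ ∧ ξ)`
(`blowUpCurrent_apply_eq`). [cite: White1989, p. 216] -/
def blowUpCurrent (σ : Measure V) (ξ : V → Multivector V (k + 1)) (a : V) (r : ℝ) :
    Current (⊤ : Opens V) (k + 1) :=
  vectorCurrent (Measure.blowUp σ (k + 1) a r) fun y => ξ (a + r • y)

omit [FiniteDimensional ℝ V] in
/-- `ξ ∘ D_{a,r}` is `σ_{a,r}`-integrable when `ξ` is `σ`-integrable. [cite: White1989, p. 216] -/
theorem integrable_comp_blowUp {E : Type*} [NormedAddCommGroup E] {σ : Measure V} {ξ : V → E}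
    (hξ : Integrable ξ σ) (a : V) {r : ℝ} (hr : 0 < r) :
    Integrable (fun y => ξ (a + r • y)) (Measure.blowUp σ (k + 1) a r) := by
  rw [Measure.blowUp]
  refine (Integrable.smul_measure ?_ ENNReal.ofReal_ne_top)
  have hme : MeasurableEmbedding fun x : V => r⁻¹ • (x - a) := by
    set e : V ≃ₜ V := (Homeomorph.addRight (-a)).trans
      (Homeomorph.smulOfNeZero r⁻¹ (inv_ne_zero hr.ne')) with he
    have hfun : (fun x : V => r⁻¹ • (x - a)) = e := by
      funext x; simp [he, sub_eq_add_neg]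
    rw [hfun]
    exact e.measurableEmbedding
  rw [hme.integrable_map_iff]
  have : (fun y : V => ξ (a + r • y)) ∘ (fun x : V => r⁻¹ • (x - a)) = ξ := by
    funext x
    simp [smul_smul, mul_inv_cancel₀ hr.ne']
  rw [this]
  exact hξ

omit [FiniteDimensional ℝ V] in
/-- **`T_{a,r}(φ) = ∫ ⟨φ(y), ξ(a + r y)⟩ dσ_{a,r}(y) = r^{-(k+1)} ∫ ⟨φ(η_{a,r} x), ξ(x)⟩ dσ(x)`.**
[cite: White1989, p. 216] -/
theorem blowUpCurrent_apply {σ : Measure V} {ξ : V → Multivector V (k + 1)} (hξ : Integrable ξ σ)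
    (a : V) {r : ℝ} (hr : 0 < r) (φ : TestForm (⊤ : Opens V) (k + 1)) :
    blowUpCurrent σ ξ a r φ = (r⁻¹) ^ (k + 1) * ∫ x, ξ x (φ (r⁻¹ • (x - a))) ∂σ := by
  rw [blowUpCurrent, vectorCurrent_apply
    ((integrable_comp_blowUp hξ a hr).locallyIntegrable.locallyIntegrableOn _),
    Measure.integral_blowUp σ (k + 1) a hr, smul_eq_mul]
  congr 1
  refine integral_congr_ae (Eventually.of_forall fun x => ?_)
  simp [smul_smul, mul_inv_cancel₀ hr.ne']

omit [FiniteDimensional ℝ V] in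
/-- The blow-up current tested against `φ` equals `σ ∧ ξ` tested against the dilated form
`x ↦ r^{-(k+1)} φ(η_{a,r} x)`. [cite: White1989, p. 216; Federer1969, 4.1.7] -/
theorem blowUpCurrent_apply_eq {σ : Measure V} {ξ : V → Multivector V (k + 1)}
    (hξ : Integrable ξ σ) (a : V) {r : ℝ} (hr : 0 < r) (φ ψ : TestForm (⊤ : Opens V) (k + 1))
    (hψ : ∀ x, ψ x = ((r⁻¹) ^ (k + 1)) • φ (r⁻¹ • (x - a))) :
    blowUpCurrent σ ξ a r φ = (vectorCurrent σ ξ : Current (⊤ : Opens V) (k + 1)) ψ := by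
  rw [blowUpCurrent_apply hξ a hr, vectorCurrent_apply (hξ.locallyIntegrable.locallyIntegrableOn _),
    ← integral_const_mul]
  refine integral_congr_ae (Eventually.of_forall fun x => ?_)
  change (r⁻¹) ^ (k + 1) * ξ x (φ (r⁻¹ • (x - a))) = ξ x (ψ x)
  rw [hψ x, (ξ x).map_smul, smul_eq_mul]

omit [FiniteDimensional ℝ V] [MeasurableSpace V] [BorelSpace V] in
/-- Dilated test forms exist: `x ↦ c • φ(r⁻¹(x − a))` is a test form. [cite: Federer1969, 4.1.7] -/
theorem exists_testForm_dilate (a : V) {r : ℝ} (hr : 0 < r) (c : ℝ) {n : ℕ}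
    (φ : TestForm (⊤ : Opens V) n) :
    ∃ ψ : TestForm (⊤ : Opens V) n, ∀ x, ψ x = c • φ (r⁻¹ • (x - a)) := by
  obtain ⟨ψ₀, hψ₀⟩ := exists_testFunction_comp_add_smul (Ω₁ := (⊤ : Opens V))
    (Ω₂ := (⊤ : Opens V)) a hr.ne' (by simp) φ
  exact ⟨c • ψ₀, fun x => by simp [hψ₀ x]⟩

omit [FiniteDimensional ℝ V] [MeasurableSpace V] [BorelSpace V] in
/-- **`d` of a dilated form**: if `χ(x) = c φ(r⁻¹(x − a))` then
`dχ(x) = (c r⁻¹) (dφ)(r⁻¹(x − a))`. [cite: Federer1969, 4.1.7] -/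
theorem extDerivCLM_dilate_apply (a : V) (r : ℝ) (c : ℝ) {n : ℕ}
    (φ χ : TestForm (⊤ : Opens V) n) (hχ : ∀ x, χ x = c • φ (r⁻¹ • (x - a))) (x : V) :
    TestForm.extDerivCLM χ x = (c * r⁻¹) • TestForm.extDerivCLM φ (r⁻¹ • (x - a)) := by
  have hfun : (⇑χ : V → Covector V n) = c • fun y => (⇑φ) ((-(r⁻¹ • a)) + r⁻¹ • y) := by
    funext y
    rw [Pi.smul_apply, hχ y, smul_sub, neg_add_eq_sub]
  rw [TestForm.extDerivCLM_apply, TestForm.extDerivCLM_apply, hfun, extDeriv_smul,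
    extDeriv_comp_add_smul _ (φ.contDiff.differentiable (by simp)) (-(r⁻¹ • a)) r⁻¹ x, smul_smul,
    smul_sub, neg_add_eq_sub]

omit [FiniteDimensional ℝ V] in
/-- **Blow-ups of cycles are cycles**: `∂(σ ∧ ξ) = 0 ⇒ ∂T_{a,r} = 0`, because
`T_{a,r}(dφ) = (σ ∧ ξ)(r^{-(k+1)} (dφ) ∘ η) = (σ ∧ ξ)(d(r^{-k} φ ∘ η)) = 0`.
[cite: White1989, p. 216; Federer1969, 4.1.7] -/
theorem boundary_blowUpCurrent_eq_zero {σ : Measure V} {ξ : V → Multivector V (k + 1)}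
    (hξ : Integrable ξ σ) (hT : (vectorCurrent σ ξ : Current (⊤ : Opens V) (k + 1)).boundary = 0)
    (a : V) {r : ℝ} (hr : 0 < r) : (blowUpCurrent σ ξ a r).boundary = 0 := by
  ext φ
  obtain ⟨χ, hχ⟩ := exists_testForm_dilate a hr ((r⁻¹) ^ k) φ
  have hdχ : ∀ x, TestForm.extDerivCLM χ x =
      ((r⁻¹) ^ (k + 1)) • TestForm.extDerivCLM φ (r⁻¹ • (x - a)) := fun x => by
    rw [extDerivCLM_dilate_apply a r _ φ χ hχ x, ← pow_succ]
  rw [Current.boundary_apply, blowUpCurrent_apply_eq hξ a hr _ _ hdχ, ← Current.boundary_apply, hT]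
  rfl

/-- The blow-up current is representable (it is `σ_{a,r} ∧ (ξ ∘ D)` with integrable vectorfield).
[cite: Federer1969, 4.1.7] -/
theorem isRepresentable_blowUpCurrent {σ : Measure V} {ξ : V → Multivector V (k + 1)}
    (hξ : Integrable ξ σ) (a : V) {r : ℝ} (hr : 0 < r) :
    (blowUpCurrent σ ξ a r).IsRepresentable :=
  isRepresentable_vectorCurrent
    ((integrable_comp_blowUp hξ a hr).locallyIntegrable.locallyIntegrableOn _)

/-- `‖T_{a,r}‖ = σ_{a,r} ⌞ ‖ξ ∘ D‖`. [cite: Federer1969, 4.1.7] -/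
theorem variation_blowUpCurrent {σ : Measure V} {ξ : V → Multivector V (k + 1)}
    (hξ : Integrable ξ σ) (a : V) {r : ℝ} (hr : 0 < r) :
    (blowUpCurrent σ ξ a r).variation =
      (Measure.blowUp σ (k + 1) a r).withDensity fun y => ‖ξ (a + r • y)‖ₑ := by
  rw [blowUpCurrent, variation_vectorCurrent_eq
    ((integrable_comp_blowUp hξ a hr).locallyIntegrable.locallyIntegrableOn _)]
  simp

/-- `𝐌(T_{a,r}) = ∫ ‖ξ ∘ D‖ dσ_{a,r} < ∞`. [cite: Federer1969, 4.1.7] -/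
theorem mass_blowUpCurrent {σ : Measure V} {ξ : V → Multivector V (k + 1)}
    (hξ : Integrable ξ σ) (a : V) {r : ℝ} (hr : 0 < r) :
    (blowUpCurrent σ ξ a r).mass = ∫⁻ y, ‖ξ (a + r • y)‖ₑ ∂(Measure.blowUp σ (k + 1) a r) :=
  mass_vectorCurrent_eq_lintegral
    ((integrable_comp_blowUp hξ a hr).locallyIntegrable.locallyIntegrableOn _)

/-- The blow-up current has finite mass. [cite: Federer1969, 4.1.7] -/
theorem mass_blowUpCurrent_ne_top {σ : Measure V} {ξ : V → Multivector V (k + 1)}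
    (hξ : Integrable ξ σ) (a : V) {r : ℝ} (hr : 0 < r) :
    (blowUpCurrent σ ξ a r).mass ≠ ⊤ := by
  rw [mass_blowUpCurrent hξ a hr]
  exact (integrable_comp_blowUp hξ a hr).2.ne

end BlowUpCurrent

/-! ### Cone limits of blow-up sequences -/

section Convergence

variable {σ : Measure V} {ξ : V → Multivector V (k + 1)} {a : V} {lam : ℕ → ℝ} {ν : Measure V}

omit [FiniteDimensional ℝ V] in
/-- Set integrals over balls under blow-up:
`∫_{𝐁(0,R)} g(a + r y) dσ_{a,r}(y) = r^{-(k+1)} ∫_{𝐁(a, rR)} g dσ`. [cite: White1989, p. 216] -/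
theorem setIntegral_comp_blowUp_closedBall (σ : Measure V) (a : V) {r : ℝ} (hr : 0 < r) (R : ℝ)
    (g : V → ℝ) :
    ∫ y in closedBall (0 : V) R, g (a + r • y) ∂(Measure.blowUp σ (k + 1) a r) =
      (r⁻¹) ^ (k + 1) * ∫ x in closedBall a (r * R), g x ∂σ := by
  rw [← integral_indicator measurableSet_closedBall, ← integral_indicator measurableSet_closedBall,
    Measure.integral_blowUp σ (k + 1) a hr, smul_eq_mul]
  congr 1
  refine integral_congr_ae (Eventually.of_forall fun x => ?_)
  have hmem : r⁻¹ • (x - a) ∈ closedBall (0 : V) R ↔ x ∈ closedBall a (r * R) := by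
    rw [mem_closedBall_zero_iff, mem_closedBall, dist_eq_norm, norm_smul, norm_inv,
      Real.norm_of_nonneg hr.le, inv_mul_le_iff₀ hr]
  have hx : a + r • (r⁻¹ • (x - a)) = x := by
    rw [smul_smul, mul_inv_cancel₀ hr.ne', one_smul, add_sub_cancel]
  change (closedBall (0 : V) R).indicator (fun y => g (a + r • y)) (r⁻¹ • (x - a)) =
    (closedBall a (r * R)).indicator g x
  by_cases h : x ∈ closedBall a (r * R)
  · rw [indicator_of_mem (hmem.2 h), indicator_of_mem h, hx]
  · rw [indicator_of_notMem (fun h' => h (hmem.1 h')), indicator_of_notMem h]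

omit [FiniteDimensional ℝ V] in
/-- Lower set integrals over balls under blow-up. [cite: White1989, p. 216] -/
theorem setLIntegral_comp_blowUp_closedBall (σ : Measure V) (a : V) {r : ℝ} (hr : 0 < r) (R : ℝ)
    (g : V → ℝ≥0∞) :
    ∫⁻ y in closedBall (0 : V) R, g (a + r • y) ∂(Measure.blowUp σ (k + 1) a r) =
      ENNReal.ofReal ((r⁻¹) ^ (k + 1)) * ∫⁻ x in closedBall a (r * R), g x ∂σ := by
  rw [← lintegral_indicator measurableSet_closedBall, ← lintegral_indicator measurableSet_closedBall,
    Measure.lintegral_blowUp σ (k + 1) a hr]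
  congr 1
  refine lintegral_congr_ae (Eventually.of_forall fun x => ?_)
  have hmem : r⁻¹ • (x - a) ∈ closedBall (0 : V) R ↔ x ∈ closedBall a (r * R) := by
    rw [mem_closedBall_zero_iff, mem_closedBall, dist_eq_norm, norm_smul, norm_inv,
      Real.norm_of_nonneg hr.le, inv_mul_le_iff₀ hr]
  have hx : a + r • (r⁻¹ • (x - a)) = x := by
    rw [smul_smul, mul_inv_cancel₀ hr.ne', one_smul, add_sub_cancel]
  change (closedBall (0 : V) R).indicator (fun y => g (a + r • y)) (r⁻¹ • (x - a)) =
    (closedBall a (r * R)).indicator g x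
  by_cases h : x ∈ closedBall a (r * R)
  · rw [indicator_of_mem (hmem.2 h), indicator_of_mem h, hx]
  · rw [indicator_of_notMem (fun h' => h (hmem.1 h')), indicator_of_notMem h]

omit [FiniteDimensional ℝ V] in
/-- The **Lebesgue-point error along a blow-up sequence**: if
`r^{-(k+1)} ∫_{𝐁(a,r)} ‖ξ − ξ(a)‖ dσ → 0` as `r ↓ 0` and `λ_l ↓ 0`, then
`∫_{𝐁(0,R)} ‖ξ(a + λ_l y) − ξ(a)‖ dσ_{a,λ_l}(y) → 0` for every `R > 0`. [cite: White1989, p. 216] -/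
theorem tendsto_setIntegral_norm_sub_blowUp (hlam : ∀ l, 0 < lam l)
    (hlam0 : Tendsto lam atTop (𝓝 0))
    (hLeb : Tendsto (fun r => (r⁻¹) ^ (k + 1) * ∫ x in closedBall a r, ‖ξ x - ξ a‖ ∂σ)
      (𝓝[>] 0) (𝓝 0)) {R : ℝ} (hR : 0 < R) :
    Tendsto (fun l => ∫ y in closedBall (0 : V) R, ‖ξ (a + lam l • y) - ξ a‖
      ∂(Measure.blowUp σ (k + 1) a (lam l))) atTop (𝓝 0) := by
  have hcomp : Tendsto (fun l => lam l * R) atTop (𝓝[>] 0) :=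
    tendsto_nhdsWithin_iff.2 ⟨by simpa using hlam0.mul_const R,
      Eventually.of_forall fun l => mul_pos (hlam l) hR⟩
  have h2 := (hLeb.comp hcomp).const_mul (R ^ (k + 1))
  rw [mul_zero] at h2
  refine h2.congr fun l => ?_
  simp only [comp_apply]
  rw [setIntegral_comp_blowUp_closedBall σ a (hlam l) R fun x => ‖ξ x - ξ a‖, ← mul_assoc]
  congr 1
  rw [mul_inv, mul_pow, ← mul_assoc, mul_right_comm, ← mul_pow, mul_inv_cancel₀ hR.ne',
    one_pow, one_mul]

/-- **Cone limits of blow-up sequences.** If `σ_{a,λ_l} → ν` vaguely (`λ_l ↓ 0`) and `a` is a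
normalised Lebesgue point of the integrable vectorfield `ξ`, then the blow-up currents converge
weakly to the cone `ν ∧ ξ(a)`: `T_{a,λ_l}(φ) → (ν ∧ ξ(a))(φ)`.
[cite: White1989, p. 216; Bandara2006, Lemma 4.1.5] -/
theorem tendsto_blowUpCurrent_apply [IsFiniteMeasure σ] [IsLocallyFiniteMeasure ν]
    (hξ : Integrable ξ σ) (hlam : ∀ l, 0 < lam l) (hlam0 : Tendsto lam atTop (𝓝 0))
    (hv : Measure.VagueTendsto (fun l => Measure.blowUp σ (k + 1) a (lam l)) ν)
    (hLeb : Tendsto (fun r => (r⁻¹) ^ (k + 1) * ∫ x in closedBall a r, ‖ξ x - ξ a‖ ∂σ)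
      (𝓝[>] 0) (𝓝 0))
    (φ : TestForm (⊤ : Opens V) (k + 1)) :
    Tendsto (fun l => blowUpCurrent σ ξ a (lam l) φ) atTop
      (𝓝 ((vectorCurrent ν (fun _ => ξ a) : Current (⊤ : Opens V) (k + 1)) φ)) := by
  obtain ⟨R, hR0, hR⟩ := φ.hasCompactSupport.isCompact.isBounded.subset_closedBall_lt 0 (0 : V)
  obtain ⟨Cφ, hCφ⟩ := φ.hasCompactSupport.exists_bound_of_continuous φ.continuous
  have hCφ0 : 0 ≤ Cφ := (norm_nonneg _).trans (hCφ 0)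
  set σl : ℕ → Measure V := fun l => Measure.blowUp σ (k + 1) a (lam l) with hσl
  haveI : ∀ l, IsFiniteMeasure (σl l) := fun l => Measure.isFiniteMeasure_blowUp σ _ a (hlam l)
  -- the error vectorfield `ξ ∘ D − ξ(a)` and the integrands
  have hξ' : Integrable (fun x => ξ x - ξ a) σ := hξ.sub (integrable_const _)
  have hint0 : ∀ l, Integrable (fun y => (ξ a) (φ y)) (σl l) := fun l =>
    ((ξ a).continuous.comp φ.continuous).integrable_of_hasCompactSupport
      (φ.hasCompactSupport.comp_left (map_zero _))
  have hmeas1 : ∀ l, AEStronglyMeasurable (fun y => (ξ (a + lam l • y) - ξ a) (φ y)) (σl l) :=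
    fun l => (covectorPairing V (k + 1)).aestronglyMeasurable_comp₂
      φ.continuous.aestronglyMeasurable (integrable_comp_blowUp hξ' a (hlam l)).1
  have hbd1 : ∀ l y, ‖(ξ (a + lam l • y) - ξ a) (φ y)‖ ≤
      Cφ * (closedBall (0 : V) R).indicator (fun y => ‖ξ (a + lam l • y) - ξ a‖) y := by
    intro l y
    by_cases hy : y ∈ closedBall (0 : V) R
    · rw [indicator_of_mem hy, mul_comm]
      exact ((ξ (a + lam l • y) - ξ a).le_opNorm _).trans
        (mul_le_mul_of_nonneg_left (hCφ y) (norm_nonneg _))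
    · have hφy : φ y = 0 := image_eq_zero_of_notMem_tsupport fun h => hy (hR h)
      rw [hφy, map_zero, norm_zero, indicator_of_notMem hy, mul_zero]
  have hint1 : ∀ l, Integrable (fun y => (ξ (a + lam l • y) - ξ a) (φ y)) (σl l) := fun l =>
    Integrable.mono' (((integrable_comp_blowUp hξ' a (hlam l)).norm.indicator
      measurableSet_closedBall).const_mul Cφ) (hmeas1 l) (Eventually.of_forall (hbd1 l))
  have hdec : ∀ l, blowUpCurrent σ ξ a (lam l) φ =
      (∫ y, (ξ a) (φ y) ∂σl l) + ∫ y, (ξ (a + lam l • y) - ξ a) (φ y) ∂σl l := by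
    intro l
    rw [blowUpCurrent, vectorCurrent_apply
      ((integrable_comp_blowUp hξ a (hlam l)).locallyIntegrable.locallyIntegrableOn _),
      ← integral_add (hint0 l) (hint1 l)]
    refine integral_congr_ae (Eventually.of_forall fun y => ?_)
    simp only [_root_.sub_apply]
    ring
  have hmain : Tendsto (fun l => ∫ y, (ξ a) (φ y) ∂σl l) atTop (𝓝 (∫ y, (ξ a) (φ y) ∂ν)) :=
    hv.tendsto_integral ((ξ a).continuous.comp φ.continuous)
      (φ.hasCompactSupport.comp_left (map_zero _))
  have herr : Tendsto (fun l => ∫ y, (ξ (a + lam l • y) - ξ a) (φ y) ∂σl l) atTop (𝓝 0) := by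
    have h3 := (tendsto_setIntegral_norm_sub_blowUp hlam hlam0 hLeb hR0).const_mul Cφ
    rw [mul_zero] at h3
    refine squeeze_zero_norm (fun l => ?_) h3
    calc ‖∫ y, (ξ (a + lam l • y) - ξ a) (φ y) ∂σl l‖
        ≤ ∫ y, Cφ * (closedBall (0 : V) R).indicator (fun y => ‖ξ (a + lam l • y) - ξ a‖) y
            ∂σl l :=
          norm_integral_le_of_norm_le (((integrable_comp_blowUp hξ' a (hlam l)).norm.indicator
            measurableSet_closedBall).const_mul Cφ) (Eventually.of_forall (hbd1 l))
      _ = Cφ * ∫ y in closedBall (0 : V) R, ‖ξ (a + lam l • y) - ξ a‖ ∂σl l := by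
          rw [integral_const_mul, integral_indicator measurableSet_closedBall]
  have hlim : (vectorCurrent ν (fun _ => ξ a) : Current (⊤ : Opens V) (k + 1)) φ =
      ∫ y, (ξ a) (φ y) ∂ν :=
    vectorCurrent_apply ((locallyIntegrable_const (ξ a)).locallyIntegrableOn _) φ
  rw [hlim]
  have h := hmain.add herr
  rw [add_zero] at h
  exact h.congr fun l => (hdec l).symm

/-- **The cone limit is a cycle**: if `σ ∧ ξ` is a cycle then so is the blow-up limit
`ν ∧ ξ(a)`. [cite: White1989, p. 216] -/
theorem boundary_blowUpLimit_eq_zero [IsFiniteMeasure σ] [IsLocallyFiniteMeasure ν]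
    (hξ : Integrable ξ σ) (hT : (vectorCurrent σ ξ : Current (⊤ : Opens V) (k + 1)).boundary = 0)
    (hlam : ∀ l, 0 < lam l) (hlam0 : Tendsto lam atTop (𝓝 0))
    (hv : Measure.VagueTendsto (fun l => Measure.blowUp σ (k + 1) a (lam l)) ν)
    (hLeb : Tendsto (fun r => (r⁻¹) ^ (k + 1) * ∫ x in closedBall a r, ‖ξ x - ξ a‖ ∂σ)
      (𝓝[>] 0) (𝓝 0)) :
    (vectorCurrent ν (fun _ => ξ a) : Current (⊤ : Opens V) (k + 1)).boundary = 0 :=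
  Current.boundary_eq_zero_of_tendsto (l := atTop)
    (tendsto_blowUpCurrent_apply hξ hlam hlam0 hv hLeb)
    fun l => boundary_blowUpCurrent_eq_zero hξ hT a (hlam l)

end Convergence

/-! ### Vague convergence on continuity sets, with continuous weights -/

section SetIntegral

variable {μs : ℕ → Measure V} {ν : Measure V}

omit [InnerProductSpace ℝ V] [FiniteDimensional ℝ V] [MeasurableSpace V] [BorelSpace V] in
/-- A continuous function vanishes on the frontier of its topological support. [folklore] -/
private theorem eq_zero_of_mem_frontier_tsupport {G : V → ℝ≥0} (hG : Continuous G) {y : V}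
    (hy : y ∈ frontier (tsupport G)) : G y = 0 := by
  by_contra h
  have hopen : IsOpen (Function.support G) := isOpen_ne_fun hG continuous_const
  have hmem : y ∈ interior (tsupport G) :=
    interior_mono (subset_tsupport G) (by rw [hopen.interior_eq]; exact h)
  exact hy.2 hmem

omit [InnerProductSpace ℝ V] [FiniteDimensional ℝ V] in
/-- `∫_A G dμ = (G μ)(A ∩ spt G)` for continuous compactly supported `G ≥ 0`. [folklore] -/
private theorem setLIntegral_eq_withDensity_inter {G : V → ℝ≥0} (μ : Measure V) {A : Set V}
    (hA : MeasurableSet A) :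
    ∫⁻ y in A, (G y : ℝ≥0∞) ∂μ = (μ.withDensity fun y => (G y : ℝ≥0∞)) (A ∩ tsupport G) := by
  have hKm : MeasurableSet (tsupport G) := (isClosed_tsupport G).measurableSet
  rw [withDensity_apply _ (hA.inter hKm)]
  have h0 : ∫⁻ y in A \ tsupport G, (G y : ℝ≥0∞) ∂μ = 0 := by
    rw [setLIntegral_congr_fun (hA.diff hKm) (g := fun _ => 0)
      (fun y hy => by rw [image_eq_zero_of_notMem_tsupport hy.2, ENNReal.coe_zero]),
      lintegral_zero]
  calc ∫⁻ y in A, (G y : ℝ≥0∞) ∂μ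
      = ∫⁻ y in (A ∩ tsupport G) ∪ (A \ tsupport G), (G y : ℝ≥0∞) ∂μ := by
        rw [inter_union_sdiff]
    _ = ∫⁻ y in A ∩ tsupport G, (G y : ℝ≥0∞) ∂μ + ∫⁻ y in A \ tsupport G, (G y : ℝ≥0∞) ∂μ :=
        lintegral_union (hA.diff hKm) (Set.disjoint_sdiff_right.mono_left inter_subset_right)
    _ = ∫⁻ y in A ∩ tsupport G, (G y : ℝ≥0∞) ∂μ := by rw [h0, add_zero]

/-- **Weighted continuity sets**: if `μ_l → ν` vaguely, `G ≥ 0` is continuous with compact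
support and `ν(∂A) = 0`, then `∫_A G dμ_l → ∫_A G dν` (apply the continuity-set statement to
the weighted measures `G μ_l → G ν` and the bounded set `A ∩ spt G`).
[cite: Mattila1995, Thm. 1.24] -/
theorem Measure.VagueTendsto.tendsto_setLIntegral_of_null_frontier
    (h : Measure.VagueTendsto μs ν) [IsLocallyFiniteMeasure ν] {G : V → ℝ≥0} (hG : Continuous G)
    (hGs : HasCompactSupport G) {A : Set V} (hA : MeasurableSet A) (hA0 : ν (frontier A) = 0) :
    Tendsto (fun l => ∫⁻ y in A, (G y : ℝ≥0∞) ∂μs l) atTop (𝓝 (∫⁻ y in A, (G y : ℝ≥0∞) ∂ν)) := by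
  set K := tsupport G with hK
  have hKm : MeasurableSet K := (isClosed_tsupport G).measurableSet
  have hGm : Measurable fun y => (G y : ℝ≥0∞) := (ENNReal.continuous_coe.comp hG).measurable
  set μG : ℕ → Measure V := fun l => (μs l).withDensity fun y => (G y : ℝ≥0∞) with hμG
  set νG : Measure V := ν.withDensity fun y => (G y : ℝ≥0∞) with hνG
  haveI : IsLocallyFiniteMeasure νG := IsLocallyFiniteMeasure.withDensity_coe hG
  have hvG : Measure.VagueTendsto μG νG := by
    intro g hg hgs
    have h1 := h (fun y => G y * g y) (hG.mul hg) (hgs.mul_left)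
    have hrw : ∀ μ : Measure V, ∫⁻ y, (g y : ℝ≥0∞) ∂(μ.withDensity fun y => (G y : ℝ≥0∞)) =
        ∫⁻ y, ((G y * g y : ℝ≥0) : ℝ≥0∞) ∂μ := fun μ => by
      rw [lintegral_withDensity_eq_lintegral_mul _ hGm
        (show Measurable (fun y => (g y : ℝ≥0∞)) from (ENNReal.continuous_coe.comp hg).measurable)]
      simp only [Pi.mul_apply, ENNReal.coe_mul]
    simp only [hμG, hνG, hrw]
    exact h1
  have hfr : νG (frontier (A ∩ K)) = 0 := by
    refine measure_mono_null ((frontier_inter_subset A K).trans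
      (union_subset_union inter_subset_left inter_subset_right)) (measure_union_null ?_ ?_)
    · rw [hνG, withDensity_apply _ isClosed_frontier.measurableSet]
      exact setLIntegral_measure_zero _ _ hA0
    · rw [hνG, withDensity_apply _ isClosed_frontier.measurableSet,
        setLIntegral_congr_fun isClosed_frontier.measurableSet (g := fun _ => 0)
          (fun y hy => by rw [eq_zero_of_mem_frontier_tsupport hG hy, ENNReal.coe_zero]),
        lintegral_zero]
  have ht := hvG.tendsto_measure_of_null_frontier (hGs.isCompact.isBounded.subset inter_subset_right)
    hfr
  simp only [hμG, hνG] at ht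
  simp_rw [setLIntegral_eq_withDensity_inter _ hA]
  exact ht

omit [InnerProductSpace ℝ V] [FiniteDimensional ℝ V] in
/-- The real set integral of a continuous compactly supported `ℝ≥0`-valued function against a
measure finite on compact sets is the (finite) lower set integral. [folklore] -/
private theorem setIntegral_coe_eq_toReal (μ : Measure V) [IsFiniteMeasureOnCompacts μ]
    {g : V → ℝ≥0} (hg : Continuous g) (hgs : HasCompactSupport g) (A : Set V) :
    ∫ y in A, (g y : ℝ) ∂μ = (∫⁻ y in A, (g y : ℝ≥0∞) ∂μ).toReal ∧
      ∫⁻ y in A, (g y : ℝ≥0∞) ∂μ ≠ ⊤ := by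
  have hint : Integrable (fun y => (g y : ℝ)) (μ.restrict A) :=
    ((NNReal.continuous_coe.comp hg).integrable_of_hasCompactSupport
      (hgs.comp_left NNReal.coe_zero)).restrict
  refine ⟨?_, ?_⟩
  · rw [integral_eq_lintegral_of_nonneg_ae (Eventually.of_forall fun y => NNReal.coe_nonneg _)
      hint.aestronglyMeasurable]
    simp
  · have := hint.2
    simpa [HasFiniteIntegral] using this.ne

/-- **Weighted continuity sets, real version**: `∫_A g dμ_l → ∫_A g dν` for continuous compactly
supported `g : V → ℝ` and `ν(∂A) = 0`. [cite: Mattila1995, Thm. 1.24] -/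
theorem Measure.VagueTendsto.tendsto_setIntegral_of_null_frontier
    (h : Measure.VagueTendsto μs ν) [∀ l, IsFiniteMeasureOnCompacts (μs l)]
    [IsLocallyFiniteMeasure ν] {g : V → ℝ} (hg : Continuous g) (hgs : HasCompactSupport g)
    {A : Set V} (hA : MeasurableSet A) (hA0 : ν (frontier A) = 0) :
    Tendsto (fun l => ∫ y in A, g y ∂μs l) atTop (𝓝 (∫ y in A, g y ∂ν)) := by
  set gp : V → ℝ≥0 := fun y => Real.toNNReal (g y) with hgp
  set gm : V → ℝ≥0 := fun y => Real.toNNReal (-g y) with hgm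
  have hgpc : Continuous gp := continuous_real_toNNReal.comp hg
  have hgmc : Continuous gm := continuous_real_toNNReal.comp hg.neg
  have hgps : HasCompactSupport gp := hgs.comp_left Real.toNNReal_zero
  have hgms : HasCompactSupport gm :=
    hgs.comp_left (g := fun t : ℝ => Real.toNNReal (-t)) (by simp)
  have hsplit : ∀ (μ : Measure V) [IsFiniteMeasureOnCompacts μ],
      ∫ y in A, g y ∂μ = (∫⁻ y in A, (gp y : ℝ≥0∞) ∂μ).toReal -
        (∫⁻ y in A, (gm y : ℝ≥0∞) ∂μ).toReal := by
    intro μ _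
    rw [← (setIntegral_coe_eq_toReal μ hgpc hgps A).1, ← (setIntegral_coe_eq_toReal μ hgmc hgms A).1,
      ← integral_sub]
    · refine integral_congr_ae (Eventually.of_forall fun y => ?_)
      simp only [hgp, hgm, Real.coe_toNNReal']
      rcases le_total 0 (g y) with hy | hy
      · rw [max_eq_left hy, max_eq_right (by linarith), sub_zero]
      · rw [max_eq_right hy, max_eq_left (by linarith)]; ring
    · exact ((NNReal.continuous_coe.comp hgpc).integrable_of_hasCompactSupport
        (hgps.comp_left NNReal.coe_zero)).restrict
    · exact ((NNReal.continuous_coe.comp hgmc).integrable_of_hasCompactSupport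
        (hgms.comp_left NNReal.coe_zero)).restrict
  simp_rw [hsplit]
  refine Tendsto.sub ?_ ?_
  · exact (ENNReal.tendsto_toReal (setIntegral_coe_eq_toReal ν hgpc hgps A).2).comp
      (h.tendsto_setLIntegral_of_null_frontier hgpc hgps hA hA0)
  · exact (ENNReal.tendsto_toReal (setIntegral_coe_eq_toReal ν hgmc hgms A).2).comp
      (h.tendsto_setLIntegral_of_null_frontier hgmc hgms hA hA0)

end SetIntegral

/-! ### Restricted cone limits and masses -/

section Restricted

variable {σ : Measure V} {ξ : V → Multivector V (k + 1)} {a : V} {lam : ℕ → ℝ} {ν : Measure V}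

/-- The restriction of a blow-up current to a Borel set `A` is `(σ_{a,r} ⌞ A) ∧ (ξ ∘ D)`.
[cite: Federer1969, 4.1.7] -/
theorem restrictSet_blowUpCurrent {σ : Measure V} {ξ : V → Multivector V (k + 1)}
    (hξ : Integrable ξ σ) (a : V) {r : ℝ} (hr : 0 < r) {A : Set V} (hA : MeasurableSet A) :
    (isRepresentable_blowUpCurrent hξ a hr).restrictSet A hA =
      (vectorCurrent ((Measure.blowUp σ (k + 1) a r).restrict A) (fun y => ξ (a + r • y)) :
        Current (⊤ : Opens V) (k + 1)) :=
  restrictSet_vectorCurrent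
    ((integrable_comp_blowUp hξ a hr).locallyIntegrable.locallyIntegrableOn _) hA

/-- **Restricted cone limits**: on a `ν`-continuity set `A` (`ν(∂A) = 0`),
`T_{a,λ_l} ⌞ A ⇀ (ν ⌞ A) ∧ ξ(a)`. [cite: White1989, p. 218; Bandara2006, Lemma 4.1.10] -/
theorem tendsto_blowUpCurrent_restrict_apply [IsFiniteMeasure σ] [IsLocallyFiniteMeasure ν]
    (hξ : Integrable ξ σ) (hlam : ∀ l, 0 < lam l) (hlam0 : Tendsto lam atTop (𝓝 0))
    (hv : Measure.VagueTendsto (fun l => Measure.blowUp σ (k + 1) a (lam l)) ν)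
    (hLeb : Tendsto (fun r => (r⁻¹) ^ (k + 1) * ∫ x in closedBall a r, ‖ξ x - ξ a‖ ∂σ)
      (𝓝[>] 0) (𝓝 0))
    {A : Set V} (hA : MeasurableSet A) (hA0 : ν (frontier A) = 0)
    (φ : TestForm (⊤ : Opens V) (k + 1)) :
    Tendsto (fun l => (vectorCurrent ((Measure.blowUp σ (k + 1) a (lam l)).restrict A)
      (fun y => ξ (a + lam l • y)) : Current (⊤ : Opens V) (k + 1)) φ) atTop
      (𝓝 ((vectorCurrent (ν.restrict A) (fun _ => ξ a) : Current (⊤ : Opens V) (k + 1)) φ)) := by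
  obtain ⟨R, hR0, hR⟩ := φ.hasCompactSupport.isCompact.isBounded.subset_closedBall_lt 0 (0 : V)
  obtain ⟨Cφ, hCφ⟩ := φ.hasCompactSupport.exists_bound_of_continuous φ.continuous
  have hCφ0 : 0 ≤ Cφ := (norm_nonneg _).trans (hCφ 0)
  set σl : ℕ → Measure V := fun l => Measure.blowUp σ (k + 1) a (lam l) with hσl
  haveI : ∀ l, IsFiniteMeasure (σl l) := fun l => Measure.isFiniteMeasure_blowUp σ _ a (hlam l)
  have hξ' : Integrable (fun x => ξ x - ξ a) σ := hξ.sub (integrable_const _)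
  have hint0 : ∀ l, Integrable (fun y => (ξ a) (φ y)) ((σl l).restrict A) := fun l =>
    (((ξ a).continuous.comp φ.continuous).integrable_of_hasCompactSupport
      (φ.hasCompactSupport.comp_left (map_zero _))).restrict
  have hmeas1 : ∀ l, AEStronglyMeasurable (fun y => (ξ (a + lam l • y) - ξ a) (φ y))
      ((σl l).restrict A) :=
    fun l => (covectorPairing V (k + 1)).aestronglyMeasurable_comp₂
      φ.continuous.aestronglyMeasurable (integrable_comp_blowUp hξ' a (hlam l)).restrict.1
  have hbd1 : ∀ l y, ‖(ξ (a + lam l • y) - ξ a) (φ y)‖ ≤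
      Cφ * (closedBall (0 : V) R).indicator (fun y => ‖ξ (a + lam l • y) - ξ a‖) y := by
    intro l y
    by_cases hy : y ∈ closedBall (0 : V) R
    · rw [indicator_of_mem hy, mul_comm]
      exact ((ξ (a + lam l • y) - ξ a).le_opNorm _).trans
        (mul_le_mul_of_nonneg_left (hCφ y) (norm_nonneg _))
    · have hφy : φ y = 0 := image_eq_zero_of_notMem_tsupport fun h => hy (hR h)
      rw [hφy, map_zero, norm_zero, indicator_of_notMem hy, mul_zero]
  have hbdint : ∀ l, Integrable (fun y => Cφ * (closedBall (0 : V) R).indicator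
      (fun y => ‖ξ (a + lam l • y) - ξ a‖) y) (σl l) := fun l =>
    ((integrable_comp_blowUp hξ' a (hlam l)).norm.indicator measurableSet_closedBall).const_mul Cφ
  have hint1 : ∀ l, Integrable (fun y => (ξ (a + lam l • y) - ξ a) (φ y)) ((σl l).restrict A) :=
    fun l => Integrable.mono' (hbdint l).restrict (hmeas1 l) (Eventually.of_forall (hbd1 l))
  have hdec : ∀ l, (vectorCurrent ((σl l).restrict A) (fun y => ξ (a + lam l • y)) :
      Current (⊤ : Opens V) (k + 1)) φ =
      (∫ y in A, (ξ a) (φ y) ∂σl l) + ∫ y in A, (ξ (a + lam l • y) - ξ a) (φ y) ∂σl l := by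
    intro l
    rw [vectorCurrent_apply
      ((integrable_comp_blowUp hξ a (hlam l)).restrict.locallyIntegrable.locallyIntegrableOn _),
      ← integral_add (hint0 l) (hint1 l)]
    refine integral_congr_ae (Eventually.of_forall fun y => ?_)
    simp only [_root_.sub_apply]
    ring
  have hmain : Tendsto (fun l => ∫ y in A, (ξ a) (φ y) ∂σl l) atTop
      (𝓝 (∫ y in A, (ξ a) (φ y) ∂ν)) :=
    hv.tendsto_setIntegral_of_null_frontier ((ξ a).continuous.comp φ.continuous)
      (φ.hasCompactSupport.comp_left (map_zero _)) hA hA0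
  have herr : Tendsto (fun l => ∫ y in A, (ξ (a + lam l • y) - ξ a) (φ y) ∂σl l) atTop (𝓝 0) := by
    have h3 := (tendsto_setIntegral_norm_sub_blowUp hlam hlam0 hLeb hR0).const_mul Cφ
    rw [mul_zero] at h3
    refine squeeze_zero_norm (fun l => ?_) h3
    calc ‖∫ y in A, (ξ (a + lam l • y) - ξ a) (φ y) ∂σl l‖
        ≤ ∫ y in A, Cφ * (closedBall (0 : V) R).indicator (fun y => ‖ξ (a + lam l • y) - ξ a‖) y
            ∂σl l :=
          norm_integral_le_of_norm_le (hbdint l).restrict (Eventually.of_forall (hbd1 l))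
      _ ≤ ∫ y, Cφ * (closedBall (0 : V) R).indicator (fun y => ‖ξ (a + lam l • y) - ξ a‖) y
            ∂σl l :=
          setIntegral_le_integral (hbdint l) (Eventually.of_forall fun y =>
            mul_nonneg hCφ0 (indicator_nonneg (fun _ _ => norm_nonneg _) _))
      _ = Cφ * ∫ y in closedBall (0 : V) R, ‖ξ (a + lam l • y) - ξ a‖ ∂σl l := by
          rw [integral_const_mul, integral_indicator measurableSet_closedBall]
  have hlim : (vectorCurrent (ν.restrict A) (fun _ => ξ a) : Current (⊤ : Opens V) (k + 1)) φ =
      ∫ y in A, (ξ a) (φ y) ∂ν :=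
    vectorCurrent_apply ((locallyIntegrable_const (ξ a)).locallyIntegrableOn _) φ
  rw [hlim]
  have h := hmain.add herr
  rw [add_zero] at h
  exact h.congr fun l => (hdec l).symm

/-- **Masses of blow-ups on compact sets**: `‖T_{a,λ_l}‖(F) ≤ ‖ξ(a)‖ σ_{a,λ_l}(F) + E_l` with
`E_l → 0`, for compact `F`. [cite: White1989, p. 218; Bandara2006, Lemma 4.1.10] -/
theorem variation_blowUpCurrent_le_add [IsFiniteMeasure σ]
    (hξ : Integrable ξ σ) (hlam : ∀ l, 0 < lam l) (hlam0 : Tendsto lam atTop (𝓝 0))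
    (hLeb : Tendsto (fun r => (r⁻¹) ^ (k + 1) * ∫ x in closedBall a r, ‖ξ x - ξ a‖ ∂σ)
      (𝓝[>] 0) (𝓝 0)) {F : Set V} (hF : IsCompact F) :
    ∃ E : ℕ → ℝ≥0∞, Tendsto E atTop (𝓝 0) ∧ ∀ l, (blowUpCurrent σ ξ a (lam l)).variation F ≤
      ‖ξ a‖ₑ * Measure.blowUp σ (k + 1) a (lam l) F + E l := by
  obtain ⟨R, hR0, hR⟩ := hF.isBounded.subset_closedBall_lt 0 (0 : V)
  have hFm : MeasurableSet F := hF.isClosed.measurableSet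
  set σl : ℕ → Measure V := fun l => Measure.blowUp σ (k + 1) a (lam l) with hσl
  haveI : ∀ l, IsFiniteMeasure (σl l) := fun l => Measure.isFiniteMeasure_blowUp σ _ a (hlam l)
  have hξ' : Integrable (fun x => ξ x - ξ a) σ := hξ.sub (integrable_const _)
  set E : ℕ → ℝ≥0∞ := fun l => ∫⁻ y in F, ‖ξ (a + lam l • y) - ξ a‖ₑ ∂σl l with hE
  refine ⟨E, ?_, fun l => ?_⟩
  · have h1 := tendsto_setIntegral_norm_sub_blowUp (σ := σ) (ξ := ξ) (a := a) hlam hlam0 hLeb hR0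
    have h2 : Tendsto (fun l => ENNReal.ofReal (∫ y in closedBall (0 : V) R,
        ‖ξ (a + lam l • y) - ξ a‖ ∂σl l)) atTop (𝓝 0) := by
      have := (ENNReal.continuous_ofReal.tendsto 0).comp h1
      rwa [ENNReal.ofReal_zero] at this
    refine tendsto_of_tendsto_of_tendsto_of_le_of_le tendsto_const_nhds h2 (fun _ => zero_le)
      fun l => ?_
    change ∫⁻ y in F, ‖ξ (a + lam l • y) - ξ a‖ₑ ∂σl l ≤ _
    rw [ofReal_integral_eq_lintegral_ofReal (integrable_comp_blowUp hξ' a (hlam l)).norm.restrict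
      (Eventually.of_forall fun y => norm_nonneg _)]
    simp_rw [ofReal_norm]
    exact lintegral_mono_set hR
  · rw [variation_blowUpCurrent hξ a (hlam l), withDensity_apply _ hFm]
    calc ∫⁻ y in F, ‖ξ (a + lam l • y)‖ₑ ∂σl l
        ≤ ∫⁻ y in F, (‖ξ a‖ₑ + ‖ξ (a + lam l • y) - ξ a‖ₑ) ∂σl l :=
          lintegral_mono fun y => by
            calc ‖ξ (a + lam l • y)‖ₑ = ‖ξ a + (ξ (a + lam l • y) - ξ a)‖ₑ := by rw [add_sub_cancel]
              _ ≤ ‖ξ a‖ₑ + ‖ξ (a + lam l • y) - ξ a‖ₑ := enorm_add_le _ _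
      _ = ‖ξ a‖ₑ * σl l F + E l := by
          rw [lintegral_add_left measurable_const, setLIntegral_const, hE]

/-- **Blow-ups do not charge `ν`-null compact sets in the limit**: if `σ_{a,λ_l} → ν` vaguely and
`ν(F) = 0` for a compact `F`, then `‖T_{a,λ_l}‖(F) → 0`.
[cite: White1989, p. 218; Bandara2006, Lemma 4.1.10] -/
theorem tendsto_variation_blowUpCurrent_of_null [IsFiniteMeasure σ] [IsLocallyFiniteMeasure ν]
    (hξ : Integrable ξ σ) (hlam : ∀ l, 0 < lam l) (hlam0 : Tendsto lam atTop (𝓝 0))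
    (hv : Measure.VagueTendsto (fun l => Measure.blowUp σ (k + 1) a (lam l)) ν)
    (hLeb : Tendsto (fun r => (r⁻¹) ^ (k + 1) * ∫ x in closedBall a r, ‖ξ x - ξ a‖ ∂σ)
      (𝓝[>] 0) (𝓝 0)) {F : Set V} (hF : IsCompact F) (hF0 : ν F = 0) :
    Tendsto (fun l => (blowUpCurrent σ ξ a (lam l)).variation F) atTop (𝓝 0) := by
  obtain ⟨E, hE0, hE⟩ := variation_blowUpCurrent_le_add hξ hlam hlam0 hLeb hF
  have hσ0 : Tendsto (fun l => Measure.blowUp σ (k + 1) a (lam l) F) atTop (𝓝 0) := by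
    have hls := hv.limsup_measure_le_of_isCompact hF
    rw [hF0] at hls
    exact tendsto_of_le_liminf_of_limsup_le (by simp) hls
  have hsum : Tendsto (fun l => ‖ξ a‖ₑ * Measure.blowUp σ (k + 1) a (lam l) F + E l) atTop
      (𝓝 0) := by
    have h1 := ENNReal.Tendsto.const_mul (a := ‖ξ a‖ₑ) hσ0 (Or.inr enorm_ne_top)
    rw [mul_zero] at h1
    simpa using h1.add hE0
  exact tendsto_of_tendsto_of_tendsto_of_le_of_le tendsto_const_nhds hsum (fun _ => zero_le) hE

end Restricted

/-! ### Uniform lower density of the blow-up limit (the Egorov trick) -/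

section LowerDensity

variable {σ : Measure V} {ξ : V → Multivector V (k + 1)} {a : V} {lam : ℕ → ℝ} {ν : Measure V}

omit [InnerProductSpace ℝ V] [FiniteDimensional ℝ V] [MeasurableSpace V] [BorelSpace V] in
/-- `A_{b,r}` maps open balls to open balls: `A(B(x,ρ)) = B(A x, rρ)` (`r > 0`).
[cite: Federer1969, 2.7.16 (1)] -/
theorem image_add_smul_ball [NormedSpace ℝ V] (b x : V) {r : ℝ} (hr : 0 < r) (ρ : ℝ) :
    (fun y : V => b + r • y) '' ball x ρ = ball (b + r • x) (r * ρ) := by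
  have e : (fun y : V => b + r • y) = (fun w : V => b +ᵥ w) ∘ fun y : V => r • y := rfl
  rw [e, Set.image_comp, Set.image_smul, _root_.smul_ball hr.ne', Set.image_vadd, Metric.vadd_ball,
    Real.norm_of_nonneg hr.le, vadd_eq_add]

omit [FiniteDimensional ℝ V] in
/-- `σ_{a,r}(B(y, s)) = r^{-(k+1)} σ(B(a + r y, r s))`. [cite: White1989, p. 216] -/
theorem blowUp_apply_ball (σ : Measure V) (a : V) {r : ℝ} (hr : 0 < r) (y : V) (s : ℝ) :
    Measure.blowUp σ (k + 1) a r (ball y s) =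
      ENNReal.ofReal ((r⁻¹) ^ (k + 1)) * σ (ball (a + r • y) (r * s)) := by
  rw [Measure.blowUp_apply σ (k + 1) a hr, image_add_smul_ball a y hr]

omit [InnerProductSpace ℝ V] [FiniteDimensional ℝ V] [MeasurableSpace V] [BorelSpace V] in
/-- Rescaling an `o(r^{k+1})` statement along `λ_l R ↓ 0`: if `r^{-(k+1)} f(r) → 0` as `r ↓ 0`
then for every `c > 0`, eventually `f(λ_l R) ≤ c λ_l^{k+1}`. [folklore] -/
private theorem eventually_le_mul_pow_of_tendsto {f : ℝ → ℝ}
    (hf : Tendsto (fun r => (r⁻¹) ^ (k + 1) * f r) (𝓝[>] 0) (𝓝 0)) (hlam : ∀ l, 0 < lam l)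
    (hlam0 : Tendsto lam atTop (𝓝 0)) {R : ℝ} (hR : 0 < R) {c : ℝ} (hc : 0 < c) :
    ∀ᶠ l in atTop, f (lam l * R) ≤ c * (lam l) ^ (k + 1) := by
  have hcomp : Tendsto (fun l => lam l * R) atTop (𝓝[>] 0) :=
    tendsto_nhdsWithin_iff.2 ⟨by simpa using hlam0.mul_const R,
      Eventually.of_forall fun l => mul_pos (hlam l) hR⟩
  have h := (hf.comp hcomp).eventually (Iic_mem_nhds (div_pos hc (pow_pos hR (k + 1))))
  filter_upwards [h] with l hl
  simp only [comp_apply] at hl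
  have htR : 0 < (lam l * R) ^ (k + 1) := pow_pos (mul_pos (hlam l) hR) _
  calc f (lam l * R) = (lam l * R) ^ (k + 1) * (((lam l * R)⁻¹) ^ (k + 1) * f (lam l * R)) := by
        rw [← mul_assoc, ← mul_pow, mul_inv_cancel₀ (mul_pos (hlam l) hR).ne', one_pow, one_mul]
    _ ≤ (lam l * R) ^ (k + 1) * (c / R ^ (k + 1)) := mul_le_mul_of_nonneg_left hl htR.le
    _ = c * lam l ^ (k + 1) := by
        rw [mul_pow]
        field_simp

/-- **Uniform lower density of the blow-up limit** (the "Egorov trick" of the programme,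
replacing White's use of the lower-density lemma on the cone [White1989, p. 217, Step 2]). Let
`σ_{a,λ_l} → ν` vaguely, `a` a normalised Lebesgue point of `ξ` with `ξ(a) ≠ 0`, and let `a` be a
density point (at scale `r^{k+1}`) of a set `M'` on which
`∫_{𝐁(x,r)} ‖ξ‖ dσ ≥ (βr)^{k+1}` for `0 < r ≤ r₁`. Then for EVERY `y ∈ spt ν` and EVERY `r > 0`,
`ν(𝐁(y,r)) ≥ (βr/2)^{k+1} / ‖ξ(a)‖`. Proof: `ν(B(y,r/2)) > 0` forces, for large `l`, a point
`x_l ∈ M' ∩ B(a + λ_l y, λ_l r/2)` (the complement of `M'` has `σ`-measure `o(λ_l^{k+1})` near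
`a`); then `(βλ_l r/2)^{k+1} ≤ ∫_{𝐁(x_l, λ_l r/2)} ‖ξ‖ ≤ ∫_{𝐁(a+λ_l y, λ_l r)} ‖ξ‖
≤ ‖ξ(a)‖ σ(𝐁(a + λ_l y, λ_l r)) + o(λ_l^{k+1})`, and `ν(𝐁(y,r)) ≥ limsup σ_{a,λ_l}(𝐁(y,r))`.
[cite: White1989, p. 217; Bandara2006, Lemma 4.1.8] -/
theorem le_blowUpLimit_closedBall [IsFiniteMeasure σ] [IsLocallyFiniteMeasure ν]
    (hξ : Integrable ξ σ) (hlam : ∀ l, 0 < lam l) (hlam0 : Tendsto lam atTop (𝓝 0))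
    (hv : Measure.VagueTendsto (fun l => Measure.blowUp σ (k + 1) a (lam l)) ν)
    (hLeb : Tendsto (fun r => (r⁻¹) ^ (k + 1) * ∫ x in closedBall a r, ‖ξ x - ξ a‖ ∂σ)
      (𝓝[>] 0) (𝓝 0))
    {M' : Set V} {β r₁ : ℝ} (hr₁ : 0 < r₁)
    (hM' : ∀ x ∈ M', ∀ r, 0 < r → r ≤ r₁ → (β * r) ^ (k + 1) ≤ ∫ x' in closedBall x r, ‖ξ x'‖ ∂σ)
    (hdens : Tendsto (fun r => (r⁻¹) ^ (k + 1) * (σ (closedBall a r \ M')).toReal)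
      (𝓝[>] 0) (𝓝 0))
    (hξa : ξ a ≠ 0) {y : V} (hy : y ∈ ν.support) {r : ℝ} (hr : 0 < r) :
    ENNReal.ofReal ((β * r / 2) ^ (k + 1) / ‖ξ a‖) ≤ ν (closedBall y r) := by
  set σl : ℕ → Measure V := fun l => Measure.blowUp σ (k + 1) a (lam l) with hσl
  haveI : ∀ l, IsFiniteMeasure (σl l) := fun l => Measure.isFiniteMeasure_blowUp σ _ a (hlam l)
  set R₁ : ℝ := ‖y‖ + r with hR₁
  have hR₁0 : 0 < R₁ := by positivity
  set L : ℝ := (β * r / 2) ^ (k + 1) / ‖ξ a‖ with hL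
  have hξa' : 0 < ‖ξ a‖ := norm_pos_iff.2 hξa
  have hξ' : Integrable (fun x => ξ x - ξ a) σ := hξ.sub (integrable_const _)
  -- Step 1: the open half-ball has positive `ν`-measure, hence eventually `σl`-measure `> v/2`
  set v : ℝ≥0∞ := ν (ball y (r / 2)) with hvdef
  have hv0 : 0 < v := (Measure.mem_support_iff_forall y).1 hy _ (ball_mem_nhds y (half_pos hr))
  have hvtop : v ≠ ⊤ := measure_ball_lt_top.ne
  have hv2 : v / 2 < v := ENNReal.half_lt_self hv0.ne' hvtop
  have hv2r : 0 < (v / 2).toReal :=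
    ENNReal.toReal_pos (ENNReal.div_pos hv0.ne' (by norm_num)).ne'
      (ENNReal.div_lt_top hvtop (by norm_num)).ne
  have e1 : ∀ᶠ l in atTop, v / 2 < σl l (ball y (r / 2)) :=
    eventually_lt_of_lt_liminf (hv2.trans_le (hv.le_liminf_measure_of_isOpen isOpen_ball))
  -- Step 2: the complement of `M'` is small near `a`
  have e2 : ∀ᶠ l in atTop, (σ (closedBall a (lam l * R₁) \ M')).toReal ≤
      ((v / 2).toReal / 2) * (lam l) ^ (k + 1) :=
    eventually_le_mul_pow_of_tendsto hdens hlam hlam0 hR₁0 (half_pos hv2r)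
  -- Step 3: the radii become admissible
  have e3 : ∀ᶠ l in atTop, lam l * r / 2 ≤ r₁ := by
    have h : Tendsto (fun l => lam l * r / 2) atTop (𝓝 (0 * r / 2)) :=
      (hlam0.mul_const r).div_const 2
    rw [zero_mul, zero_div] at h
    exact h.eventually (Iic_mem_nhds hr₁)
  -- the key estimate, for every `ε > 0`
  have key : ∀ ε : ℝ, 0 < ε → ∀ᶠ l in atTop, ENNReal.ofReal (L - ε) ≤ σl l (closedBall y r) := by
    intro ε hε
    have e5 : ∀ᶠ l in atTop, ∫ x in closedBall a (lam l * R₁), ‖ξ x - ξ a‖ ∂σ ≤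
        (ε * ‖ξ a‖) * (lam l) ^ (k + 1) :=
      eventually_le_mul_pow_of_tendsto hLeb hlam hlam0 hR₁0 (mul_pos hε hξa')
    filter_upwards [e1, e2, e3, e5] with l h1 h2 h3 h5
    have ht : 0 < lam l := hlam l
    have htp : 0 < lam l ^ (k + 1) := pow_pos ht _
    -- Step 1': unpack `h1`
    have h1' : (v / 2).toReal < (lam l)⁻¹ ^ (k + 1) *
        (σ (ball (a + lam l • y) (lam l * (r / 2)))).toReal := by
      have h1a : v / 2 < ENNReal.ofReal ((lam l)⁻¹ ^ (k + 1)) *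
          σ (ball (a + lam l • y) (lam l * (r / 2))) := by
        have := h1; simp only [hσl] at this; rwa [blowUp_apply_ball σ a ht] at this
      have := ENNReal.toReal_strict_mono
        (ENNReal.mul_ne_top ENNReal.ofReal_ne_top (measure_ne_top σ _)) h1a
      rwa [ENNReal.toReal_mul, ENNReal.toReal_ofReal (by positivity)] at this
    -- a point of `M'` in the small ball
    have hsub1 : ball (a + lam l • y) (lam l * (r / 2)) ⊆ closedBall a (lam l * R₁) := by
      intro z hz
      rw [mem_ball] at hz
      rw [mem_closedBall]
      calc dist z a ≤ dist z (a + lam l • y) + dist (a + lam l • y) a := dist_triangle _ _ _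
        _ ≤ lam l * (r / 2) + lam l * ‖y‖ := add_le_add hz.le (by
            rw [dist_eq_norm, add_sub_cancel_left, norm_smul, Real.norm_of_nonneg ht.le])
        _ ≤ lam l * R₁ := by rw [hR₁]; nlinarith
    have hne : (ball (a + lam l • y) (lam l * (r / 2)) ∩ M').Nonempty := by
      by_contra hempty
      rw [not_nonempty_iff_eq_empty] at hempty
      have hle : σ (ball (a + lam l • y) (lam l * (r / 2))) ≤ σ (closedBall a (lam l * R₁) \ M') :=
        measure_mono fun z hz => ⟨hsub1 hz, fun hzM => by
          have : z ∈ ball (a + lam l • y) (lam l * (r / 2)) ∩ M' := ⟨hz, hzM⟩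
          rw [hempty] at this
          exact this⟩
      have hle' := ENNReal.toReal_mono (measure_ne_top σ _) hle
      have : (v / 2).toReal < (v / 2).toReal :=
        calc (v / 2).toReal
            < (lam l)⁻¹ ^ (k + 1) * (σ (ball (a + lam l • y) (lam l * (r / 2)))).toReal := h1'
          _ ≤ (lam l)⁻¹ ^ (k + 1) * (σ (closedBall a (lam l * R₁) \ M')).toReal :=
              mul_le_mul_of_nonneg_left hle' (by positivity)
          _ ≤ (lam l)⁻¹ ^ (k + 1) * (((v / 2).toReal / 2) * (lam l) ^ (k + 1)) :=
              mul_le_mul_of_nonneg_left h2 (by positivity)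
          _ = (v / 2).toReal / 2 := by
              rw [mul_comm, mul_assoc, ← mul_pow, mul_inv_cancel₀ ht.ne', one_pow, mul_one]
          _ < (v / 2).toReal := half_lt_self hv2r
      exact lt_irrefl _ this
    obtain ⟨x, hxball, hxM⟩ := hne
    -- the lower bound at `x` and the inclusions of balls
    have h4 : (β * (lam l * r / 2)) ^ (k + 1) ≤ ∫ x' in closedBall x (lam l * r / 2), ‖ξ x'‖ ∂σ :=
      hM' x hxM _ (by positivity) h3
    have hsub2 : closedBall x (lam l * r / 2) ⊆ closedBall (a + lam l • y) (lam l * r) := by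
      intro z hz
      rw [mem_closedBall] at hz ⊢
      rw [mem_ball] at hxball
      calc dist z (a + lam l • y) ≤ dist z x + dist x (a + lam l • y) := dist_triangle _ _ _
        _ ≤ lam l * r / 2 + lam l * (r / 2) := add_le_add hz hxball.le
        _ = lam l * r := by ring
    have hsub3 : closedBall (a + lam l • y) (lam l * r) ⊆ closedBall a (lam l * R₁) := by
      intro z hz
      rw [mem_closedBall] at hz ⊢
      calc dist z a ≤ dist z (a + lam l • y) + dist (a + lam l • y) a := dist_triangle _ _ _
        _ ≤ lam l * r + lam l * ‖y‖ := add_le_add hz (by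
            rw [dist_eq_norm, add_sub_cancel_left, norm_smul, Real.norm_of_nonneg ht.le])
        _ = lam l * R₁ := by rw [hR₁]; ring
    set S : Set V := closedBall (a + lam l • y) (lam l * r) with hS
    have h6 : ∫ x' in closedBall x (lam l * r / 2), ‖ξ x'‖ ∂σ ≤ ∫ x' in S, ‖ξ x'‖ ∂σ :=
      setIntegral_mono_set hξ.norm.integrableOn (Eventually.of_forall fun _ => norm_nonneg _)
        (Eventually.of_forall hsub2)
    have h7 : ∫ x' in S, ‖ξ x'‖ ∂σ ≤ ‖ξ a‖ * (σ S).toReal + ∫ x' in S, ‖ξ x' - ξ a‖ ∂σ := by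
      calc ∫ x' in S, ‖ξ x'‖ ∂σ ≤ ∫ x' in S, (‖ξ a‖ + ‖ξ x' - ξ a‖) ∂σ :=
            integral_mono hξ.norm.integrableOn
              ((integrable_const _).add hξ'.norm.integrableOn) fun x' =>
              norm_le_norm_add_norm_sub' (ξ x') (ξ a)
        _ = ‖ξ a‖ * (σ S).toReal + ∫ x' in S, ‖ξ x' - ξ a‖ ∂σ := by
            rw [integral_add (integrable_const _) hξ'.norm.integrableOn, setIntegral_const,
              smul_eq_mul, mul_comm, Measure.real]
    have h8 : ∫ x' in S, ‖ξ x' - ξ a‖ ∂σ ≤ ∫ x' in closedBall a (lam l * R₁), ‖ξ x' - ξ a‖ ∂σ :=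
      setIntegral_mono_set hξ'.norm.integrableOn (Eventually.of_forall fun _ => norm_nonneg _)
        (Eventually.of_forall hsub3)
    -- combine
    have hc : (β * (lam l * r / 2)) ^ (k + 1) = lam l ^ (k + 1) * (β * r / 2) ^ (k + 1) := by
      rw [show β * (lam l * r / 2) = lam l * (β * r / 2) by ring, mul_pow]
    have hchain : lam l ^ (k + 1) * (β * r / 2) ^ (k + 1) ≤
        ‖ξ a‖ * (σ S).toReal + (ε * ‖ξ a‖) * lam l ^ (k + 1) := by
      rw [← hc]; linarith [h4, h6, h7, h8, h5]
    have hreal : L - ε ≤ (lam l)⁻¹ ^ (k + 1) * (σ S).toReal := by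
      rw [hL, sub_le_iff_le_add, div_le_iff₀ hξa']
      have : (β * r / 2) ^ (k + 1) ≤ ‖ξ a‖ * ((lam l)⁻¹ ^ (k + 1) * (σ S).toReal) + ε * ‖ξ a‖ := by
        rw [← mul_le_mul_iff_of_pos_left htp]
        calc lam l ^ (k + 1) * (β * r / 2) ^ (k + 1)
            ≤ ‖ξ a‖ * (σ S).toReal + (ε * ‖ξ a‖) * lam l ^ (k + 1) := hchain
          _ = lam l ^ (k + 1) * (‖ξ a‖ * ((lam l)⁻¹ ^ (k + 1) * (σ S).toReal) + ε * ‖ξ a‖) := by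
              rw [inv_pow]
              field_simp
      linarith
    calc ENNReal.ofReal (L - ε) ≤ ENNReal.ofReal ((lam l)⁻¹ ^ (k + 1) * (σ S).toReal) :=
          ENNReal.ofReal_le_ofReal hreal
      _ = σl l (closedBall y r) := by
          rw [ENNReal.ofReal_mul (by positivity), ENNReal.ofReal_toReal (measure_ne_top σ _)]
          simp only [hσl]
          rw [Measure.blowUp_apply_closedBall σ (k + 1) a ht y r]
  -- pass to the limit in `l`, then let `ε → 0`
  have hls : limsup (fun l => σl l (closedBall y r)) atTop ≤ ν (closedBall y r) :=
    hv.limsup_measure_le_of_isCompact (isCompact_closedBall y r)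
  have hge : ∀ ε : ℝ, 0 < ε → ENNReal.ofReal (L - ε) ≤ ν (closedBall y r) := fun ε hε =>
    (le_liminf_of_le (h := key ε hε)).trans ((liminf_le_limsup (u := fun l => σl l (closedBall y r))).trans hls)
  have htend : Tendsto (fun ε : ℝ => ENNReal.ofReal (L - ε)) (𝓝[>] 0) (𝓝 (ENNReal.ofReal L)) := by
    have h : Tendsto (fun ε : ℝ => L - ε) (𝓝[>] 0) (𝓝 (L - 0)) :=
      (tendsto_const_nhds.sub tendsto_id).mono_left nhdsWithin_le_nhds
    rw [sub_zero] at h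
    exact (ENNReal.continuous_ofReal.tendsto L).comp h
  exact le_of_tendsto htend (eventually_nhdsWithin_of_forall fun ε hε => hge ε hε)

end LowerDensity

/-! ### Growth of the blow-up limit -/

section Growth

variable {σ : Measure V} {a : V} {lam : ℕ → ℝ} {ν : Measure V}

/-- **Growth of the blow-up limit from `Θ^{*(k+1)}(σ, a) ≤ 1`**: if for every `t > 1`,
eventually (as `r ↓ 0`) `σ(𝐁(a,r)) ≤ t α(k+1) r^{k+1}`, and `σ_{a,λ_l} → ν` vaguely with
`λ_l ↓ 0`, then `ν(B(0,R)) ≤ α(k+1) R^{k+1}` for every `R > 0`.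
[cite: White1989, p. 217; Federer1969, 2.10.19 (5)] -/
theorem blowUpLimit_ball_le [IsLocallyFiniteMeasure ν] (hlam : ∀ l, 0 < lam l)
    (hlam0 : Tendsto lam atTop (𝓝 0))
    (hv : Measure.VagueTendsto (fun l => Measure.blowUp σ (k + 1) a (lam l)) ν)
    (hup : ∀ t : ℝ≥0∞, 1 < t → ∀ᶠ r in 𝓝[>] (0 : ℝ),
      σ (closedBall a r) ≤ t * (unitBallVolume (k + 1) * ENNReal.ofReal (r ^ (k + 1))))
    {R : ℝ} (hR : 0 < R) :
    ν (ball 0 R) ≤ unitBallVolume (k + 1) * ENNReal.ofReal (R ^ (k + 1)) := by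
  have hcomp : Tendsto (fun l => lam l * R) atTop (𝓝[>] 0) :=
    tendsto_nhdsWithin_iff.2 ⟨by simpa using hlam0.mul_const R,
      Eventually.of_forall fun l => mul_pos (hlam l) hR⟩
  have hli : ν (ball 0 R) ≤ liminf (fun l => Measure.blowUp σ (k + 1) a (lam l) (ball 0 R)) atTop :=
    hv.le_liminf_measure_of_isOpen isOpen_ball
  refine ENNReal.le_of_forall_lt_one_mul_le fun c hc => ?_
  rcases eq_or_ne c 0 with rfl | hc0
  · simp
  have hct : c ≠ ⊤ := (hc.trans ENNReal.one_lt_top).ne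
  have ht : (1 : ℝ≥0∞) < c⁻¹ := ENNReal.one_lt_inv.2 hc
  have hev : ∀ᶠ l in atTop, Measure.blowUp σ (k + 1) a (lam l) (ball 0 R) ≤
      c⁻¹ * (unitBallVolume (k + 1) * ENNReal.ofReal (R ^ (k + 1))) := by
    filter_upwards [hcomp.eventually (hup c⁻¹ ht)] with l hl
    have ht0 : 0 < lam l := hlam l
    have hone : ENNReal.ofReal ((lam l)⁻¹ ^ (k + 1)) * ENNReal.ofReal ((lam l * R) ^ (k + 1)) =
        ENNReal.ofReal (R ^ (k + 1)) := by
      rw [← ENNReal.ofReal_mul (by positivity), mul_pow, ← mul_assoc, ← mul_pow,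
        inv_mul_cancel₀ ht0.ne', one_pow, one_mul]
    calc Measure.blowUp σ (k + 1) a (lam l) (ball 0 R)
        ≤ Measure.blowUp σ (k + 1) a (lam l) (closedBall 0 R) := measure_mono ball_subset_closedBall
      _ = ENNReal.ofReal ((lam l)⁻¹ ^ (k + 1)) * σ (closedBall a (lam l * R)) := by
          rw [Measure.blowUp_apply_closedBall σ (k + 1) a (hlam l), smul_zero, add_zero]
      _ ≤ ENNReal.ofReal ((lam l)⁻¹ ^ (k + 1)) *
          (c⁻¹ * (unitBallVolume (k + 1) * ENNReal.ofReal ((lam l * R) ^ (k + 1)))) :=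
          mul_le_mul' le_rfl hl
      _ = c⁻¹ * (unitBallVolume (k + 1) *
          (ENNReal.ofReal ((lam l)⁻¹ ^ (k + 1)) * ENNReal.ofReal ((lam l * R) ^ (k + 1)))) := by
          ring
      _ = c⁻¹ * (unitBallVolume (k + 1) * ENNReal.ofReal (R ^ (k + 1))) := by rw [hone]
  have hlim : liminf (fun l => Measure.blowUp σ (k + 1) a (lam l) (ball 0 R)) atTop ≤
      c⁻¹ * (unitBallVolume (k + 1) * ENNReal.ofReal (R ^ (k + 1))) :=
    liminf_le_of_frequently_le' (Eventually.frequently hev)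
  calc c * ν (ball 0 R) ≤ c * (c⁻¹ * (unitBallVolume (k + 1) * ENNReal.ofReal (R ^ (k + 1)))) :=
        mul_le_mul' le_rfl (hli.trans hlim)
    _ = unitBallVolume (k + 1) * ENNReal.ofReal (R ^ (k + 1)) := by
        rw [← mul_assoc, ENNReal.mul_inv_cancel hc0 hct, one_mul]

/-- The same bound for closed balls: `ν(𝐁(0,R)) ≤ α(k+1) R^{k+1}`.
[cite: White1989, p. 217; Federer1969, 2.10.19 (5)] -/
theorem blowUpLimit_closedBall_le [IsLocallyFiniteMeasure ν] (hlam : ∀ l, 0 < lam l)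
    (hlam0 : Tendsto lam atTop (𝓝 0))
    (hv : Measure.VagueTendsto (fun l => Measure.blowUp σ (k + 1) a (lam l)) ν)
    (hup : ∀ t : ℝ≥0∞, 1 < t → ∀ᶠ r in 𝓝[>] (0 : ℝ),
      σ (closedBall a r) ≤ t * (unitBallVolume (k + 1) * ENNReal.ofReal (r ^ (k + 1))))
    {R : ℝ} (hR : 0 < R) :
    ν (closedBall 0 R) ≤ unitBallVolume (k + 1) * ENNReal.ofReal (R ^ (k + 1)) := by
  have hbd : ∀ δ : ℝ, 0 < δ → ν (closedBall 0 R) ≤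
      unitBallVolume (k + 1) * ENNReal.ofReal ((R + δ) ^ (k + 1)) := fun δ hδ =>
    (measure_mono (closedBall_subset_ball (by linarith))).trans
      (blowUpLimit_ball_le hlam hlam0 hv hup (by linarith))
  have htend : Tendsto (fun δ : ℝ => unitBallVolume (k + 1) * ENNReal.ofReal ((R + δ) ^ (k + 1)))
      (𝓝[>] 0) (𝓝 (unitBallVolume (k + 1) * ENNReal.ofReal ((R + 0) ^ (k + 1)))) := by
    refine ENNReal.Tendsto.const_mul ?_ (Or.inr (unitBallVolume_ne_top _))
    exact ((ENNReal.continuous_ofReal.tendsto _).comp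
      (((continuous_const.add continuous_id).pow (k + 1)).tendsto 0)).mono_left nhdsWithin_le_nhds
  rw [add_zero] at htend
  exact ge_of_tendsto htend (eventually_nhdsWithin_of_forall fun δ hδ => hbd δ hδ)

end Growth

/-! ### Structure of the blow-up limit: invariance, dimension, simplicity -/

section Structure

variable {σ : Measure V} {ξ : V → Multivector V (k + 1)} {a : V} {lam : ℕ → ℝ} {ν : Measure V}

/-- **Translation invariance of the blow-up limit**: `ν` is invariant under the invariant
subspace `W_{ξ(a)}` of the limit vectorfield (the cone `ν ∧ ξ(a)` is a cycle; `ConstantVectorfield`).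
[cite: White1989, p. 217; Bandara2006, Lemma 4.1.6] -/
theorem blowUpLimit_map_add_eq_self [IsFiniteMeasure σ] [IsLocallyFiniteMeasure ν]
    (hξ : Integrable ξ σ) (hT : (vectorCurrent σ ξ : Current (⊤ : Opens V) (k + 1)).boundary = 0)
    (hlam : ∀ l, 0 < lam l) (hlam0 : Tendsto lam atTop (𝓝 0))
    (hv : Measure.VagueTendsto (fun l => Measure.blowUp σ (k + 1) a (lam l)) ν)
    (hLeb : Tendsto (fun r => (r⁻¹) ^ (k + 1) * ∫ x in closedBall a r, ‖ξ x - ξ a‖ ∂σ)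
      (𝓝[>] 0) (𝓝 0)) {w : V} (hw : w ∈ (ξ a).invariantSubspace) :
    ν.map (· + w) = ν :=
  map_add_eq_self_of_boundary_vectorCurrent_eq_zero (ξ a)
    (boundary_blowUpLimit_eq_zero hξ hT hlam hlam0 hv hLeb) hw

/-- **The invariant subspace has dimension exactly `k + 1`** when the limit has uniform lower
density `ν(𝐁(y,r)) ≥ c r^{k+1}` at its support points (`TranslationInvariantMeasures`) and
`ξ(a) ≠ 0` (`ConstantVectorfield`). [cite: White1989, p. 217; Bandara2006, Lemma 4.1.9] -/
theorem finrank_invariantSubspace_blowUpLimit [IsFiniteMeasure σ] [IsLocallyFiniteMeasure ν]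
    (hξ : Integrable ξ σ) (hT : (vectorCurrent σ ξ : Current (⊤ : Opens V) (k + 1)).boundary = 0)
    (hlam : ∀ l, 0 < lam l) (hlam0 : Tendsto lam atTop (𝓝 0))
    (hv : Measure.VagueTendsto (fun l => Measure.blowUp σ (k + 1) a (lam l)) ν)
    (hLeb : Tendsto (fun r => (r⁻¹) ^ (k + 1) * ∫ x in closedBall a r, ‖ξ x - ξ a‖ ∂σ)
      (𝓝[>] 0) (𝓝 0)) (hξa : ξ a ≠ 0) (hν : ν ≠ 0) {c : ℝ≥0∞} (hc : c ≠ 0)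
    (hld : ∀ y ∈ ν.support, ∀ r : ℝ, 0 < r → c * ENNReal.ofReal (r ^ (k + 1)) ≤ ν (closedBall y r)) :
    Module.finrank ℝ (ξ a).invariantSubspace = k + 1 :=
  le_antisymm
    (Measure.finrank_le_of_map_add_eq_self (W := (ξ a).invariantSubspace) (r₀ := 1)
      (fun _ hw => blowUpLimit_map_add_eq_self hξ hT hlam hlam0 hv hLeb hw) hν hc one_pos
      fun y hy r hr _ => hld y hy r hr)
    ((ξ a).le_finrank_invariantSubspace hξa)

omit [MeasurableSpace V] [BorelSpace V] in
/-- **The limit vectorfield is simple**: `ξ(a) = ⟨e^♭, ξ(a)⟩ e₀ ∧ ⋯ ∧ e_k` for any orthonormal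
frame `e` of the invariant subspace, once that subspace has dimension `k + 1`.
[cite: White1989, p. 217; Bandara2006, Lemma 4.1.9] -/
theorem blowUpLimit_vectorfield_eq_smul_frameVector (ξ : V → Multivector V (k + 1)) (a : V)
    (hdim : Module.finrank ℝ (ξ a).invariantSubspace = k + 1) {e : Fin (k + 1) → V}
    (he : Orthonormal ℝ e) (heW : ∀ j, e j ∈ (ξ a).invariantSubspace) :
    ξ a = (ξ a) (frameCovector e) • frameVector e :=
  (ξ a).eq_smul_frameVector_of_finrank_invariantSubspace_eq hdim he heW

end Structure

end Literature.Geometry.GeometricMeasureTheory
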